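import Literature.Computability.AlgebraicComplexity.KRSTDesign
import Literature.Computability.AlgebraicComplexity.KabanetsImpagliazzoGenerator
import Literature.Computability.AlgebraicComplexity.PermanentIrreducible
import Summits.ValiantsHypothesis.ValiantsHypothesis.Theorems.BarrierLeverPartitionMinorsGenericChowProduct
import HarnessLib

/-!
# DefinabilityGap — the AFFINE RUNG of the planted Kabanets–Impagliazzo permanent generator (unconditional)

Route `route-ValiantsHypothesis-DefinabilityGap` (decomp-valiant cycle 1, lens 5: hardness–randomness / PIT axis),
supporting the hitting items `KIPlantedHitting` (stmt-ValiantsHypothesis-23547) and its weakly-skew / read-once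
children. The object: `G_m : ℂ^{q²} → ℂ^{q³}`, `q = q(m)` the least prime `≥ m² + 1`, coordinate
`c ∈ 𝔽_q³ ↦ per_m(y|S_c)` — the `m × m` permanent read on the first `m²` cells of the quadratic curve
`S_c = {(i, c₀ + c₁ i + c₂ i²)}` (the objects `qOf`, `quadDesign`, `kiPer` below are definitionally the inlined terms of
the route file `Summits/ValiantsHypothesis/ValiantsHypothesis/Theses/DefinabilityGap.lean`).

MAIN THEOREM `kiPer_hits_affine`: for every `m ≥ 3`, NO nonzero polynomial of total degree `≤ 1` in the `q³`
variables annihilates `G_m` (equivalently `kiPer_linearIndependent`: the `q³` coordinates are linearly independent and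
non-constant). This is the degree-one layer of the read-once-ABP rung of the route (affine-linear polynomials are
width-2 ROABPs in any order) and is NOT a consequence of the support-counting rung (supports here are arbitrary, up to
`q³ ≫ m²` variables). It is SHARP: at `m = 2` there are 80 independent linear annihilators (route folder,
`instrument-kiper-relations.md`). Proof: the diagonal monomial `∏_i y_{E_c(i,i)}` of block `c` has coefficient `1` in
`per_m(y|S_c)` (`coeff_permMonomial_perPoly` transported along the injective renaming) and coefficient `0` in every
other coordinate, because a monomial of `per_m(y|S_{c'})` occupies `m ≥ 3` cells of `S_{c'}` while two quadratic
curves share `≤ 2` cells (`isNWDesign_polyBlock 2`). 0 sorry.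
-/

noncomputable section

open MvPolynomial
open Literature.Computability.AlgebraicComplexity Literature.Computability.MetaComplexity

namespace Summit.ValiantsHypothesis.ValiantsHypothesis.Theorems.DefinabilityGapAffineRung

/-- The field size `q(m)`: the least prime `≥ m² + 1` (so `m² < q(m) ≤ 2(m²+1)` by Bertrand,
`leastPrimeGe_le`). [folklore] -/
def qOf (m : ℕ) : ℕ := leastPrimeGe (m * m + 1)

/-- `q(m)` is a prime `≥ m² + 1`. [folklore] -/
theorem qOf_spec (m : ℕ) : m * m + 1 ≤ qOf m ∧ (qOf m).Prime := leastPrimeGe_spec _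

/-- `m² ≤ q(m)`. [folklore] -/
theorem sq_le_qOf (m : ℕ) : m * m ≤ qOf m := (Nat.le_succ _).trans (qOf_spec m).1

/-- **The quadratic-curve design** (Nisan–Wigderson polynomial design of degree `2` over `𝔽_q`,
all `q³` curves, transported to `Fin q × Fin q`): block `c ↦ {(i, c₀ + c₁ i + c₂ i²) : i ∈ 𝔽_q}`;
`q³` blocks of size `q` in a universe of size `q²`, pairwise intersections `≤ 2`
(`isNWDesign_polyBlock 2`). [folklore] -/
def quadDesign (m : ℕ) (c : Fin 3 → Fin (qOf m)) : Fin (qOf m) ↪ Fin (qOf m) × Fin (qOf m) :=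
  haveI : Fact (qOf m).Prime := ⟨(qOf_spec m).2⟩
  haveI : NeZero (qOf m) := ⟨(qOf_spec m).2.ne_zero⟩
  let E : Fin (qOf m) ≃ ZMod (qOf m) := (ZMod.finEquiv (qOf m)).toEquiv
  (polyBlock (d := 2) E.toEmbedding (fun i => E (c i))).trans
    (E.symm.prodCongr E.symm).toEmbedding

/-- **The KI-planted permanent map** `G_m : ℂ^{q²} → ℂ^{q³}`, coordinate `c ↦ per_m(y|S_c)`
(the padded permanent `perPad` = `per_m` on the first `m²` cells of the block `S_c`).
[cite: KabanetsImpagliazzo2003, Lemma 30; KumarRamyaSaptharishiTengse2022, §3.4] -/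
def kiPer (m : ℕ) : (Fin 3 → Fin (qOf m)) → MvPolynomial (Fin (qOf m) × Fin (qOf m)) ℂ :=
  kiGenerator (perPad ℂ (sq_le_qOf m)) (quadDesign m)


/-- **The quadratic-curve design is an NW design with pairwise intersections `≤ 2`**
(`isNWDesign_polyBlock 2`, re-indexed along `c ↦ E ∘ c` and transported along `E⁻¹ × E⁻¹`). [folklore] -/
theorem quadDesign_isNWDesign (m : ℕ) : IsNWDesign 2 (quadDesign m) := by
  haveI : Fact (qOf m).Prime := ⟨(qOf_spec m).2⟩
  haveI : NeZero (qOf m) := ⟨(qOf_spec m).2.ne_zero⟩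
  let E : Fin (qOf m) ≃ ZMod (qOf m) := (ZMod.finEquiv (qOf m)).toEquiv
  have hg : Function.Injective (fun c : Fin 3 → Fin (qOf m) => fun i => E (c i)) := by
    intro c c' h
    funext i
    exact E.injective (congrFun h i)
  exact ((isNWDesign_polyBlock 2 E.toEmbedding).comp_injective hg).trans
    (E.symm.prodCongr E.symm).toEmbedding


section AffineRung

variable {m : ℕ}

/-- Support of a permutation monomial: the graph `{(ρ c, c)}`. [folklore] -/
theorem support_permMonomial {n : Type*} [Fintype n] [DecidableEq n] (ρ : Equiv.Perm n) :
    (permMonomial ρ).support =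
      Finset.univ.map ⟨fun c => (ρ c, c), fun _ _ h => (Prod.mk.inj h).2⟩ := by
  ext ⟨r, c⟩
  rw [Finsupp.mem_support_iff, permMonomial_apply, Finset.mem_map]
  constructor
  · intro h
    have hc : ρ c = r := by
      by_contra hne
      exact h (if_neg hne)
    exact ⟨c, Finset.mem_univ _, by simp [hc]⟩
  · rintro ⟨c', -, hc'⟩
    simp only [Function.Embedding.coeFn_mk, Prod.mk.injEq] at hc'
    obtain ⟨h1, rfl⟩ := hc'
    rw [if_pos h1]
    exact one_ne_zero

/-- A permutation monomial has `|n|` cells. [folklore] -/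
theorem card_support_permMonomial {n : Type*} [Fintype n] [DecidableEq n] (ρ : Equiv.Perm n) :
    (permMonomial ρ).support.card = Fintype.card n := by
  rw [support_permMonomial, Finset.card_map, Finset.card_univ]

/-- The embedding of the `m × m` permanent cells of coordinate `c` into the seed universe `𝔽_q × 𝔽_q`. [this file] -/
def cellEmb (m : ℕ) (c : Fin 3 → Fin (qOf m)) : Fin m × Fin m ↪ Fin (qOf m) × Fin (qOf m) :=
  (permPad (sq_le_qOf m)).trans (quadDesign m c)

/-- `G_m(c) = per_m` renamed along `cellEmb m c`. [this file] -/
theorem kiPer_eq_rename_cellEmb (m : ℕ) (c : Fin 3 → Fin (qOf m)) :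
    kiPer m c = rename (cellEmb m c) (perPoly (Fin m) ℂ) := by
  simp only [kiPer, kiGenerator_apply, perPad, rename_rename]
  rfl

/-- The diagonal monomial `∏_i y_{E_c(i,i)}` of block `c`. [this file] -/
def diagMonomial (m : ℕ) (c : Fin 3 → Fin (qOf m)) : (Fin (qOf m) × Fin (qOf m)) →₀ ℕ :=
  Finsupp.mapDomain (cellEmb m c) (permMonomial (1 : Equiv.Perm (Fin m)))

/-- The diagonal monomial of block `c` has `m` cells. [this file] -/
theorem card_support_diagMonomial (m : ℕ) (c : Fin 3 → Fin (qOf m)) :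
    (diagMonomial m c).support.card = m := by
  rw [diagMonomial, Finsupp.mapDomain_support_of_injective (cellEmb m c).injective,
    Finset.card_image_of_injective _ (cellEmb m c).injective, card_support_permMonomial, Fintype.card_fin]

/-- A monomial pushed along `cellEmb m c` lives inside the block `S_c`. [this file] -/
theorem support_mapDomain_cellEmb_subset (m : ℕ) (c : Fin 3 → Fin (qOf m)) (u : Fin m × Fin m →₀ ℕ) :
    (Finsupp.mapDomain (cellEmb m c) u).support ⊆ Finset.univ.map (quadDesign m c) := by
  rw [Finsupp.mapDomain_support_of_injective (cellEmb m c).injective]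
  intro x hx
  obtain ⟨y, -, rfl⟩ := Finset.mem_image.1 hx
  exact Finset.mem_map.2 ⟨permPad (sq_le_qOf m) y, Finset.mem_univ _, rfl⟩

/-- The diagonal monomial of block `c` has coefficient `1` in `G_m(c)`. [this file] -/
theorem coeff_diagMonomial_kiPer_self (m : ℕ) (c : Fin 3 → Fin (qOf m)) :
    coeff (diagMonomial m c) (kiPer m c) = 1 := by
  rw [kiPer_eq_rename_cellEmb, diagMonomial, coeff_rename_mapDomain _ (cellEmb m c).injective,
    coeff_permMonomial_perPoly]

/-- … and coefficient `0` in every other coordinate once `m ≥ 3` (design intersections `≤ 2`). [this file] -/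
theorem coeff_diagMonomial_kiPer_ne (hm : 3 ≤ m) {c c' : Fin 3 → Fin (qOf m)} (hcc' : c' ≠ c) :
    coeff (diagMonomial m c) (kiPer m c') = 0 := by
  by_contra h
  rw [kiPer_eq_rename_cellEmb] at h
  obtain ⟨u, hu, hcoeff⟩ := coeff_rename_ne_zero _ _ _ h
  obtain ⟨ρ, rfl⟩ := exists_permMonomial_eq_of_coeff_perPoly_ne_zero ℂ hcoeff
  have h1 : (diagMonomial m c).support ⊆ Finset.univ.map (quadDesign m c) :=
    support_mapDomain_cellEmb_subset m c _
  have h2 : (diagMonomial m c).support ⊆ Finset.univ.map (quadDesign m c') := by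
    rw [← hu]
    exact support_mapDomain_cellEmb_subset m c' _
  have hle : (diagMonomial m c).support.card ≤ 2 :=
    (Finset.card_le_card (Finset.subset_inter h2 h1)).trans (quadDesign_isNWDesign m hcc')
  have hcard := card_support_diagMonomial m c
  omega

/-- **Coefficient extraction**: for affine-linear `D` (total degree `≤ 1`) and `m ≥ 3`, the coefficient of the diagonal
monomial of block `c` in `D ∘ G_m` is the coefficient of `z_c` in `D`. [this file] -/
theorem coeff_diagMonomial_bind₁_kiPer (hm : 3 ≤ m) (D : MvPolynomial (Fin 3 → Fin (qOf m)) ℂ)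
    (hdeg : D.totalDegree ≤ 1) (c : Fin 3 → Fin (qOf m)) :
    coeff (diagMonomial m c) (bind₁ (kiPer m) D) = coeff (Finsupp.single c 1) D := by
  classical
  have hμ0 : diagMonomial m c ≠ 0 := by
    intro h0
    have h1 := card_support_diagMonomial m c
    rw [h0, Finsupp.support_zero, Finset.card_empty] at h1
    omega
  conv_lhs => rw [D.as_sum, map_sum, coeff_sum]
  have hterm : ∀ d ∈ D.support, coeff (diagMonomial m c) (bind₁ (kiPer m) (monomial d (coeff d D))) =
      if d = Finsupp.single c 1 then coeff d D else 0 := by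
    intro d hd
    have hd1 : (d.sum fun _ e => e) ≤ 1 := (le_totalDegree hd).trans hdeg
    rcases BarrierLever.ChowFactor.finsupp_eq_zero_or_single_of_degree_le_one d hd1 with rfl | ⟨v, rfl⟩
    · rw [← C_apply, bind₁_C_right, coeff_C, if_neg (fun h => hμ0 h.symm),
        if_neg (fun h => (Finsupp.single_ne_zero.2 one_ne_zero) h.symm)]
    · rw [bind₁_monomial, Finsupp.support_single _ one_ne_zero, Finset.prod_singleton,
        Finsupp.single_eq_same, pow_one, coeff_C_mul]
      by_cases hvc : v = c
      · subst hvc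
        rw [coeff_diagMonomial_kiPer_self, mul_one, if_pos rfl]
      · rw [coeff_diagMonomial_kiPer_ne hm hvc, mul_zero, if_neg]
        intro h
        exact hvc (Finsupp.single_left_injective one_ne_zero h)
  rw [Finset.sum_congr rfl hterm, Finset.sum_ite_eq']
  split_ifs with hmem
  · rfl
  · exact (notMem_support_iff.1 hmem).symm

/-- **The affine rung (unconditional, kernel): for `m ≥ 3` no nonzero polynomial of total degree `≤ 1` — in all
`q(m)³` variables — annihilates the KI-planted permanent map.** Sharp: false at `m = 2`. [this file] -/
theorem kiPer_hits_affine (hm : 3 ≤ m) (D : MvPolynomial (Fin 3 → Fin (qOf m)) ℂ) (hD : D ≠ 0)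
    (hdeg : D.totalDegree ≤ 1) : bind₁ (kiPer m) D ≠ 0 := by
  classical
  by_cases hlin : ∃ c, coeff (Finsupp.single c 1) D ≠ 0
  · obtain ⟨c, hc⟩ := hlin
    intro h0
    have h1 := coeff_diagMonomial_bind₁_kiPer hm D hdeg c
    rw [h0, coeff_zero] at h1
    exact hc h1.symm
  · push Not at hlin
    have hDC : D = C (coeff 0 D) := by
      ext d
      rw [coeff_C]
      split_ifs with h0
      · subst h0
        rfl
      · by_contra hne
        have hd : d ∈ D.support := mem_support_iff.2 hne
        have hd1 : (d.sum fun _ e => e) ≤ 1 := (le_totalDegree hd).trans hdeg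
        rcases BarrierLever.ChowFactor.finsupp_eq_zero_or_single_of_degree_le_one d hd1 with rfl | ⟨v, rfl⟩
        · exact h0 rfl
        · exact hne (hlin v)
    rw [hDC, bind₁_C_right, Ne, C_eq_zero]
    intro h00
    apply hD
    rw [hDC, h00, C_0]

/-- The linear coordinates of `G_m` are linearly independent for `m ≥ 3` (equivalent packaging). [this file] -/
theorem kiPer_linearIndependent (hm : 3 ≤ m) : LinearIndependent ℂ (kiPer m) := by
  classical
  rw [linearIndependent_iff']
  intro s g hsum c hc
  -- read off the coefficient of the diagonal monomial of block `c`
  have h := congrArg (coeff (diagMonomial m c)) hsum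
  rw [coeff_sum, coeff_zero, Finset.sum_eq_single c] at h
  · rwa [smul_eq_C_mul, coeff_C_mul, coeff_diagMonomial_kiPer_self, mul_one] at h
  · intro c' _ hc'
    rw [smul_eq_C_mul, coeff_C_mul, coeff_diagMonomial_kiPer_ne hm hc', mul_zero]
  · intro hcs
    exact absurd hc hcs

end AffineRung

end Summit.ValiantsHypothesis.ValiantsHypothesis.Theorems.DefinabilityGapAffineRung

end
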